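import Mathlib
import Summits.NavierStokesRegularity.NavierStokesRegularity.Theorems.ThreadingFluxSilentShellsJiuXinSlabAbsorb
import HarnessLib

/-!
# Crux `PoloidalLiouville` (stmt-NavierStokesRegularity-1222, W1), crux idea «silent-shells» (ns-idea-15 g8):
# the PRINTED Jiu–Xin Liouville theorem `jiuXin2008_thm53` — PROVED

**Theorem** (Q. Jiu, Z. Xin, *Smooth approximations and exact solutions of the 3D steady axisymmetric Euler equations*,
Comm. Math. Phys. 287 (2009) 323–350, Theorem 5.3).  Let `u, p ∈ C¹(ℝ³)` solve the steady Euler equations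
`div u = 0`, `(u·∇)u + ∇p = 0`, with `u` axisymmetric WITHOUT swirl, `u ∈ L²(ℝ³)`, `|u| → 0` and `p → p₀` at infinity.
Then `u ≡ 0`.

This is the silent-shells sketch Prop `SilentShells.jiuXin2008_thm53` (`Cruxes/PoloidalLiouville/SilentShellsSketch.lean`
v1.4 l.279 — «Jiu–Xin 2009, Theorem 5.3 AS PRINTED», there a CANDIDATE NAMED FACT) BY NAME, with the sketch-local
`IsSteadyEulerC1 U P` δ-unfolded, now a KERNEL THEOREM: the named fact is retired.

Proof (files `…JiuXinSlabField/SlabLimit/SlabIdentity/SlabBounds/SlabAbsorb`, this one) — NOT Jiu–Xin's weak-convergence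
argument but the regularised virial route of the compact case (`ThreadingFluxSilentShellsJiuXinLiouville`) localised to
slabs: testing the Euler pair against `χ_R η_Z² x_h/(ρ²+ε²)` and letting `R → ∞` (horizontal tail killed by `p → p₀` alone,
cylinder volumes by Haar scaling), then `ε → 0⁺` (axis Bernoulli `p − p₀ = −½u₂² ≤ 0` from rest at infinity, the
vertical cut-off's cross term ABSORBED into `½∫η_Z²|u_h|²/ρ²` at the price `(64S²/9)‖u‖²_{L²}/Z²`), then `Z → ∞`
(monotonicity of `η_Z`): `∫|u_h|²/ρ² = 0` slab by slab, so `u_h ≡ 0`, `∂₂u₂ = div u = 0`, and `u → 0` along vertical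
lines gives `u ≡ 0`.  `C¹` throughout, no decay rates, no cylindrical coordinates, no Fubini.

`--supports stmt-NavierStokesRegularity-1222 --as helper`.  W1 movement 0; ⟨1222⟩ OPEN; NS regularity is NOT proved by
any of this (a Liouville theorem for steady axisymmetric Euler flows without swirl).
-/

-- the summit and its single problem share the name (D-0017 nested layout)
set_option linter.dupNamespace false

noncomputable section

namespace Summit.NavierStokesRegularity.NavierStokesRegularity.Theorems.PoloidalLiouville.SilentShells

open Set Function Filter MeasureTheory Topology Metric
open scoped Topology RealInnerProductSpace
open Literature.Analysis.FluidPDE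
open Summit.NavierStokesRegularity.NavierStokesRegularity.Theorems.PoloidalLiouville.HorizonTower (E3)

namespace JiuXin

section Euler

variable {U : E3 → E3} {P : E3 → ℝ}

/-- **No horizontal velocity.** Under the hypotheses of Jiu–Xin's theorem, `U₀ ≡ U₁ ≡ 0` (slab estimate
`∫η_Z²|U_h|²/ρ² ≤ C/Z²`, monotonicity of `η_Z` in `Z`, continuity). -/
theorem horizontal_eq_zero (hU : ContDiff ℝ 1 U) (hP : ContDiff ℝ 1 P) (hdiv : VectorCalculus.IsDivFree U)
    (hE : ∀ x, convect U U x + gradient P x = 0) (hax : IsAxisymmetric U) (hsw : HasNoSwirl U)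
    (hL2 : MemLp U 2 (volume : Measure E3)) (hU0 : Tendsto U (cocompact E3) (𝓝 0)) {p₀ : ℝ}
    (hp : Tendsto P (cocompact E3) (𝓝 p₀)) (x : E3) : U x 0 = 0 ∧ U x 1 = 0 := by
  obtain ⟨C, hC⟩ := slab_horSq_le hU hP hdiv hE hax hsw hL2 hU0 hp
  have hUd : Differentiable ℝ U := hU.differentiable one_ne_zero
  set hs : E3 → ℝ := fun y => U y 0 * U y 0 + U y 1 * U y 1 with hhs
  have hs0 : ∀ y, 0 ≤ hs y := horSq_nonneg U
  -- the slab through `x`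
  set Z₀ : ℝ := |x 2| + 1 with hZ₀
  have hZ₀0 : 0 < Z₀ := by positivity
  set L₀ : ℝ := ∫ y, vertCut Z₀ y ^ 2 * (hs y / cylSq y) with hL₀
  have hi₀ : Integrable (fun y => vertCut Z₀ y ^ 2 * (hs y / cylSq y)) (volume : Measure E3) :=
    integrable_vertCut_sq_horSq_div hU hax hL2 hZ₀0
  -- `L₀ ≤ C/Z²` for all `Z ≥ Z₀`, hence `L₀ ≤ 0`
  have hle : ∀ Z : ℝ, Z₀ ≤ Z → L₀ ≤ C / Z ^ 2 := by
    intro Z hZ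
    have hZ0 : 0 < Z := hZ₀0.trans_le hZ
    refine (integral_mono hi₀ (integrable_vertCut_sq_horSq_div hU hax hL2 hZ0) fun y => ?_).trans (hC Z hZ0)
    exact mul_le_mul_of_nonneg_right (pow_le_pow_left₀ (vertCut_nonneg Z₀ y) (vertCut_mono hZ₀0 hZ y) 2)
      (div_nonneg (hs0 y) (cylSq_nonneg y))
  have hL₀le : L₀ ≤ 0 := by
    have hlim : Tendsto (fun Z : ℝ => C / Z ^ 2) atTop (𝓝 0) :=
      tendsto_const_nhds.div_atTop (tendsto_pow_atTop two_ne_zero)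
    exact ge_of_tendsto hlim (by filter_upwards [eventually_ge_atTop Z₀] with Z hZ using hle Z hZ)
  have hL₀ge : 0 ≤ L₀ := integral_nonneg fun y => mul_nonneg (sq_nonneg _) (div_nonneg (hs0 y) (cylSq_nonneg y))
  have hL₀0 : L₀ = 0 := le_antisymm hL₀le hL₀ge
  -- the continuous minorant `η_{Z₀}² hs/(ρ²+1)` integrates to zero, hence vanishes
  set g : E3 → ℝ := fun y => vertCut Z₀ y ^ 2 * (hs y / (cylSq y + 1)) with hg
  have hq1 : ∀ y : E3, 0 < cylSq y + 1 := fun y => by have := cylSq_nonneg y; positivity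
  have hgc : Continuous g := ((contDiff_vertCut (n := 0) Z₀).continuous.pow 2).mul
    ((continuous_horSq hU.continuous).div (continuous_cylSq.add continuous_const) fun y => (hq1 y).ne')
  have hg0 : ∀ y, 0 ≤ g y := fun y => mul_nonneg (sq_nonneg _) (div_nonneg (hs0 y) (hq1 y).le)
  have hgle : ∀ y, g y ≤ vertCut Z₀ y ^ 2 * (hs y / cylSq y) := by
    intro y
    refine mul_le_mul_of_nonneg_left ?_ (sq_nonneg _)
    by_cases hq : cylSq y = 0
    · have : hs y = 0 := horSq_eq_zero_of_cylSq_eq_zero hax hUd hq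
      simp [this]
    · exact div_le_div_of_nonneg_left (hs0 y) (lt_of_le_of_ne (cylSq_nonneg y) (Ne.symm hq)) (by linarith)
  have hgi : Integrable g (volume : Measure E3) :=
    Integrable.mono' hi₀ hgc.aestronglyMeasurable (Eventually.of_forall fun y => by
      rw [Real.norm_eq_abs, abs_of_nonneg (hg0 y)]; exact hgle y)
  have hgint : ∫ y, g y = 0 :=
    le_antisymm ((integral_mono hgi hi₀ hgle).trans hL₀le) (integral_nonneg hg0)
  have hg_zero : g = 0 := by
    have hae : g =ᵐ[volume] 0 := (integral_eq_zero_iff_of_nonneg hg0 hgi).mp hgint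
    exact (Continuous.ae_eq_iff_eq volume hgc continuous_const).mp hae
  -- at `x`: `η_{Z₀}(x) = 1`
  have h1 : vertCut Z₀ x = 1 := vertCut_eq_one hZ₀0 (by rw [hZ₀]; linarith)
  have h2 : g x = 0 := congrFun hg_zero x
  have h3 : hs x = 0 := by
    have h2' : vertCut Z₀ x ^ 2 * (hs x / (cylSq x + 1)) = 0 := by simpa only [hg] using h2
    rw [h1, one_pow, one_mul, div_eq_zero_iff] at h2'
    exact h2'.resolve_right (hq1 x).ne'
  simp only [hhs] at h3
  constructor <;> nlinarith [mul_self_nonneg (U x 0), mul_self_nonneg (U x 1)]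

end Euler

end JiuXin

open JiuXin in
/-- **Jiu–Xin 2009, Theorem 5.3 AS PRINTED** — silent-shells sketch v1.4 l.279 `jiuXin2008_thm53` BY NAME (body verbatim,
the sketch-local `IsSteadyEulerC1 U P` δ-unfolded): a `C¹` steady Euler pair on `ℝ³` that is axisymmetric WITHOUT swirl,
square-integrable, vanishing at infinity, with `p → p₀` at infinity, has `u ≡ 0`. [cite: JiuXin2008, Thm 5.3]
The kernel proof is the slab-localised `G_ε`-virial argument (see the module docstring), not the paper's. -/
theorem jiuXin2008_thm53 :
    ∀ (U : EuclideanSpace ℝ (Fin 3) → EuclideanSpace ℝ (Fin 3)) (P : EuclideanSpace ℝ (Fin 3) → ℝ),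
      (ContDiff ℝ 1 U ∧ ContDiff ℝ 1 P ∧ VectorCalculus.IsDivFree U ∧
          ∀ x, convect U U x + gradient P x = 0) →
        IsAxisymmetric U → HasNoSwirl U → MemLp U 2 volume →
          Tendsto U (cocompact (EuclideanSpace ℝ (Fin 3))) (𝓝 0) →
            (∃ p₀ : ℝ, Tendsto P (cocompact (EuclideanSpace ℝ (Fin 3))) (𝓝 p₀)) → U = 0 := by
  intro U P hEul hax hsw hL2 hU0 hP0
  obtain ⟨hU, hP, hdiv, hE⟩ := hEul
  obtain ⟨p₀, hp⟩ := hP0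
  have hUd : Differentiable ℝ U := hU.differentiable one_ne_zero
  -- (1) `U_h ≡ 0`
  have hU01 : ∀ x, U x 0 = 0 ∧ U x 1 = 0 := horizontal_eq_zero hU hP hdiv hE hax hsw hL2 hU0 hp
  -- (2) `∂₂U₂ = div U = 0`
  set e : EuclideanSpace ℝ (Fin 3) := EuclideanSpace.single 2 (1 : ℝ) with he
  have hcoord0 : ∀ (i : Fin 3), (∀ x, U x i = 0) → ∀ y v, fderiv ℝ U y v i = 0 := by
    intro i hi y v
    have hcomp : HasFDerivAt (fun z => U z i)
        ((EuclideanSpace.proj i : EuclideanSpace ℝ (Fin 3) →L[ℝ] ℝ).comp (fderiv ℝ U y)) y :=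
      (EuclideanSpace.proj i : EuclideanSpace ℝ (Fin 3) →L[ℝ] ℝ).hasFDerivAt.comp y (hUd y).hasFDerivAt
    have hzero : HasFDerivAt (fun z => U z i) (0 : EuclideanSpace ℝ (Fin 3) →L[ℝ] ℝ) y := by
      have : (fun z => U z i) = fun _ => (0 : ℝ) := funext (hi ·)
      rw [this]; exact hasFDerivAt_const 0 y
    have := congrArg (fun L : EuclideanSpace ℝ (Fin 3) →L[ℝ] ℝ => L v) (hcomp.unique hzero)
    simpa using this
  have hd2 : ∀ y, fderiv ℝ U y e 2 = 0 := by
    intro y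
    have hdy := hdiv y
    rw [divergence_eq_sum_inner_fderiv (EuclideanSpace.basisFun (Fin 3) ℝ)] at hdy
    simp only [Fin.sum_univ_three, EuclideanSpace.basisFun_apply, EuclideanSpace.inner_single_left] at hdy
    have h0 := hcoord0 0 (fun x => (hU01 x).1) y (EuclideanSpace.single 0 (1 : ℝ))
    have h1 := hcoord0 1 (fun x => (hU01 x).2) y (EuclideanSpace.single 1 (1 : ℝ))
    rw [h0, h1] at hdy
    simpa [he] using hdy
  -- (3) `U₂` is constant on vertical lines and `U → 0` along them
  have he1 : ‖e‖ = 1 := by simp [he]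
  have hU2 : ∀ x, U x 2 = 0 := by
    intro x
    set h : ℝ → ℝ := fun t => U (x + t • e) 2 with hh
    have hd : ∀ t, HasDerivAt h 0 t := by
      intro t
      have hl : HasDerivAt (fun t : ℝ => x + t • e) e t := by
        simpa using ((hasDerivAt_id t).smul_const e).const_add x
      have h1 : HasDerivAt (fun t : ℝ => U (x + t • e)) (fderiv ℝ U (x + t • e) e) t :=
        (hUd _).hasFDerivAt.comp_hasDerivAt t hl
      have h2 : HasDerivAt (fun t : ℝ => U (x + t • e) 2) (fderiv ℝ U (x + t • e) e 2) t :=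
        (EuclideanSpace.proj (2 : Fin 3) : EuclideanSpace ℝ (Fin 3) →L[ℝ] ℝ).hasFDerivAt.comp_hasDerivAt t h1
      rw [hd2] at h2
      exact h2
    have hconst := is_const_of_deriv_eq_zero (fun t => (hd t).differentiableAt) fun t => (hd t).deriv
    -- `|U₂ x| ≤ η` for every `η > 0`
    have habs : ∀ η : ℝ, 0 < η → |U x 2| ≤ η := by
      intro η hη
      obtain ⟨R₀, hR₀, hfar⟩ := exists_radius_of_tendsto_cocompact_zero hU0 hη
      set t : ℝ := R₀ + ‖x‖ with ht
      have hfarpt : R₀ ≤ ‖x + t • e‖ := by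
        have hn : ‖t • e‖ = t := by
          rw [norm_smul, he1, mul_one, Real.norm_of_nonneg (by positivity)]
        have htri : ‖t • e‖ ≤ ‖x + t • e‖ + ‖x‖ := by
          have := norm_sub_le (x + t • e) x
          rwa [add_sub_cancel_left] at this
        linarith
      have h1 : ‖U (x + t • e)‖ ≤ η := hfar _ hfarpt
      have h2 : U x 2 = U (x + t • e) 2 := by
        have := hconst 0 t
        simpa [hh] using this
      rw [h2]
      exact (((pow_le_pow_iff_left₀ (abs_nonneg _) (norm_nonneg _) two_ne_zero).mp (sq_abs_apply_two_le_norm_sq _))).trans h1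
    have : |U x 2| ≤ 0 := le_of_forall_pos_le_add fun η hη => by linarith [habs η hη]
    exact abs_nonpos_iff.mp this
  -- (4) done
  funext x
  ext i
  fin_cases i
  · simpa using (hU01 x).1
  · simpa using (hU01 x).2
  · simpa using hU2 x


/-- **… and `p ≡ p₀`** (the second conclusion of [JiuXin2008, Thm 5.3] as printed): under the same hypotheses the
pressure is the constant `p₀` — `u ≡ 0` gives `∇p = −(u·∇)u = 0`, so `p` is constant on the connected `ℝ³`, and the
constant is its limit at infinity. [cite: JiuXin2008, Thm 5.3] -/
theorem jiuXin2008_thm53_pressure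
    {U : EuclideanSpace ℝ (Fin 3) → EuclideanSpace ℝ (Fin 3)} {P : EuclideanSpace ℝ (Fin 3) → ℝ}
    (hE : ContDiff ℝ 1 U ∧ ContDiff ℝ 1 P ∧ VectorCalculus.IsDivFree U ∧ ∀ x, convect U U x + gradient P x = 0)
    (hax : IsAxisymmetric U) (hsw : HasNoSwirl U) (hL2 : MemLp U 2 volume)
    (hU0 : Tendsto U (cocompact (EuclideanSpace ℝ (Fin 3))) (𝓝 0)) {p₀ : ℝ}
    (hp : Tendsto P (cocompact (EuclideanSpace ℝ (Fin 3))) (𝓝 p₀)) : ∀ x, P x = p₀ := by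
  have hU : U = 0 := jiuXin2008_thm53 U P hE hax hsw hL2 hU0 ⟨p₀, hp⟩
  have hPd : Differentiable ℝ P := hE.2.1.differentiable one_ne_zero
  -- `∇P ≡ 0`
  have hgrad : ∀ x, fderiv ℝ P x = 0 := by
    intro x
    have h1 := hE.2.2.2 x
    rw [convect_apply, hU] at h1
    simp only [Pi.zero_apply, map_zero, zero_add] at h1
    have : fderiv ℝ P x = (InnerProductSpace.toDual ℝ (EuclideanSpace ℝ (Fin 3))) (gradient P x) := by
      simp [gradient]
    rw [this, h1, map_zero]
  -- `P` is constant, and the constant is the limit at infinity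
  have hconst : ∀ x y, P x = P y := fun x y => is_const_of_fderiv_eq_zero hPd hgrad x y
  intro x
  have hPc : P = fun _ => P x := funext fun y => hconst y x
  have hlim : Tendsto (fun _ : EuclideanSpace ℝ (Fin 3) => P x) (cocompact (EuclideanSpace ℝ (Fin 3))) (𝓝 p₀) := by
    rw [← hPc]; exact hp
  exact tendsto_nhds_unique tendsto_const_nhds hlim

end Summit.NavierStokesRegularity.NavierStokesRegularity.Theorems.PoloidalLiouville.SilentShells

end
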